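import Mathlib.Analysis.Convolution
import Mathlib.Analysis.Calculus.ContDiff.FiniteDimension
import Mathlib.Analysis.Calculus.ParametricIntegral
import Mathlib.MeasureTheory.Function.ContinuousMapDense
import Literature.Analysis.FunctionSpaces.TorusMollifier
import Literature.Analysis.FunctionSpaces.TorusCalculusProofs
import Literature.Analysis.FunctionSpaces.TorusSpaceTime
import Literature.Analysis.UnboundedOperators.HeatKernel
import HarnessLib

/-!
# Convolution and mollification on the flat torus `T^d`

Analysis/FunctionSpaces support file (serves the discharge of the DiPerna–Lions uniqueness fact
`Literature.Analysis.FluidPDE.Torus.IsWeakScalarTransportOn.unique_of_lipschitz`, `FluidPDE/PassiveScalar`, whose proof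
regularises a weak solution in space, `θ_ε(t) = θ(t) ⋆ k_ε`; DiPerna–Lions 1989, §II.1, proof of
Thm. II.1, and Evans, App. C.4, Thm. 7 (properties of mollifiers)).

The torus `UnitAddTorus d` is a compact abelian group with Haar probability measure `volume`, so
Mathlib's group convolution `θ ⋆[L, volume] k`, `(θ ⋆ k)(x) = ∫ θ(y) • k(x - y) dy`, is available
(`Mathlib.Analysis.Convolution`); but Mathlib's *smoothing* theorems
(`HasCompactSupport.contDiff_convolution_right`, …) require a normed vector space. Smoothness on
the torus is expressed through the periodic lift (`Torus.IsSmooth`, `FlatTorus`), and this file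
proves the mollification theorems directly on `T^d`:

* reflected kernels `y ↦ k (x - y)`: smoothness and `D`, `∂ᵢ`, `∇`, `Δ` (`Torus.fderiv_comp_sub_left`, …);
* `Torus.lift_convolution`: `lift (θ ⋆ k) w = ∫ θ y • lift k (w - reprc y) dy`;
* `Torus.hasFDerivAt_lift_convolution`: differentiation under the integral sign —
  `D (lift (θ ⋆ k)) = lift (θ ⋆ Dk)` for `θ ∈ L¹(T^d)` and `k ∈ C¹` (dominated convergence,
  Mathlib's `hasFDerivAt_integral_of_dominated_of_fderiv_le`; the derivative of the periodic
  lift of `k` is bounded because `T^d` is compact);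
* `Torus.isSmooth_convolution`: `θ ⋆ k` is smooth for `θ ∈ L¹` and smooth `k` (induction on the
  order through `contDiff_succ_iff_fderiv_apply`, the codomain staying fixed), with
  `∂ᵢ (θ ⋆ k) = θ ⋆ ∂ᵢ k`, `∇(θ ⋆ k) = θ ⋆ ∇k`, `Δ(θ ⋆ k) = θ ⋆ Δk`
  (Evans, App. C.4, Thm. 7 (i));
* Young's inequality `‖θ ⋆ k‖_{Lᵖ} ≤ ‖k‖_{L¹} ‖θ‖_{Lᵖ}` for real `θ`, `k` (commutativity on the
  abelian torus and the tree's `Literature.Analysis.UnboundedOperators.eLpNorm_convolution_le_lintegral_enorm_mul`);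
* approximate identities: for continuous `g`, `k ⋆ g → g` uniformly along kernels `k ≥ 0` of
  unit mass supported in small balls (Mathlib's `dist_convolution_le`), and the `L²` convergence
  `θ ⋆ kernel εₙ → θ` for `θ ∈ L²(T^d)`, `εₙ → 0` (Evans, App. C.4, Thm. 7 (iv), via the density of
  continuous functions, Mathlib's `MemLp.exists_boundedContinuous_eLpNorm_sub_le`);
* measurability of parametrised convolutions `(a, x) ↦ (Θ a ⋆ k)(x)` on `α × T^d`
  (Fubini, Mathlib's `AEStronglyMeasurable.integral_prod_right'`), used for time-dependent `θ`.

## References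

* R. J. DiPerna, P.-L. Lions, *Ordinary differential equations, transport theory and Sobolev
  spaces*, Invent. Math. 98 (1989), 511–547, §II.1.
* L. C. Evans, *Partial Differential Equations*, 2nd ed. (AMS 2010), App. C.4, Thm. 7.
* L. Grafakos, *Classical Fourier Analysis*, 3rd ed. (2014), §3.1.1, §1.2.
-/

noncomputable section

open MeasureTheory TopologicalSpace Set Function Filter Topology Metric ContinuousLinearMap
open scoped ENNReal NNReal Convolution ContDiff InnerProductSpace

namespace Literature.Analysis.FunctionSpaces

namespace Torus

variable {d : Type*} [Fintype d]
variable {F : Type*} [NormedAddCommGroup F] [NormedSpace ℝ F]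

/-! ## Reflected kernels `y ↦ k (x - y)` -/

section Reflect

omit [Fintype d] in
/-- `proj (a - b) = proj a - proj b`. [folklore] -/
@[simp]
theorem proj_sub (a b : EuclideanSpace ℝ d) : proj (a - b) = proj a - proj b := rfl

omit [Fintype d] [NormedSpace ℝ F] [NormedAddCommGroup F] in
/-- The re-centred lift of a reflected kernel: `liftAt (k (x - ·)) y v = liftAt k (x - y) (-v)`. [folklore] -/
theorem liftAt_comp_sub_left (k : UnitAddTorus d → F) (x y : UnitAddTorus d) :
    liftAt (fun y => k (x - y)) y = fun v => liftAt k (x - y) (-v) := by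
  funext v
  simp only [liftAt_apply, proj_neg]
  congr 1
  abel

omit [Fintype d] [NormedSpace ℝ F] [NormedAddCommGroup F] in
/-- The lift of a reflected kernel: `lift (k (x - ·)) = lift k (w - ·)` for `proj w = x`. [folklore] -/
theorem lift_comp_sub_left (k : UnitAddTorus d → F) {x : UnitAddTorus d} {w : EuclideanSpace ℝ d}
    (hw : proj w = x) : lift (fun y => k (x - y)) = fun v => lift k (w - v) := by
  funext v
  simp [← hw]

/-- Reflected `C^n` kernels are `C^n`. [folklore] -/
theorem IsContDiff.comp_sub_left {n : WithTop ℕ∞} {k : UnitAddTorus d → F} (hk : IsContDiff n k)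
    (x : UnitAddTorus d) : IsContDiff n (fun y => k (x - y)) := by
  obtain ⟨w, rfl⟩ := proj_surjective x
  change ContDiff ℝ n (lift fun y => k (proj w - y))
  rw [lift_comp_sub_left k rfl]
  exact (hk : ContDiff ℝ n (lift k)).comp (contDiff_const.sub contDiff_id)

/-- Reflected smooth kernels are smooth. [folklore] -/
theorem IsSmooth.comp_sub_left {k : UnitAddTorus d → F} (hk : IsSmooth k) (x : UnitAddTorus d) :
    IsSmooth (fun y => k (x - y)) :=
  IsContDiff.comp_sub_left hk x

/-- The torus derivative of a reflected kernel: `D(k (x - ·))(y) = -Dk (x - y)` (no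
differentiability needed: both sides are junk `0` together). [folklore] -/
theorem fderiv_comp_sub_left (k : UnitAddTorus d → F) (x y : UnitAddTorus d) :
    Torus.fderiv (fun y => k (x - y)) y = -Torus.fderiv k (x - y) := by
  rw [Torus.fderiv, liftAt_comp_sub_left, Torus.fderiv]
  have h := fderiv_comp_smul (-1 : ℝ) (f := liftAt k (x - y)) (x := 0)
  simp only [neg_one_smul, smul_zero] at h
  exact h

variable [DecidableEq d] in
/-- Partial derivatives of a reflected `C¹` kernel: `∂ᵢ (k (x - ·))(y) = -∂ᵢ k (x - y)`. [folklore] -/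
theorem partialDeriv_comp_sub_left {k : UnitAddTorus d → F} (hk : IsContDiff 1 k) (i : d)
    (x y : UnitAddTorus d) :
    partialDeriv i (fun y => k (x - y)) y = -partialDeriv i k (x - y) := by
  rw [partialDeriv_eq_fderiv_apply (hk.comp_sub_left x), partialDeriv_eq_fderiv_apply hk,
    fderiv_comp_sub_left k, _root_.neg_apply]

/-- The gradient of a reflected scalar kernel: `∇(k (x - ·))(y) = -∇k (x - y)`. [folklore] -/
theorem gradient_comp_sub_left (k : UnitAddTorus d → ℝ) (x y : UnitAddTorus d) :
    Torus.gradient (fun y => k (x - y)) y = -Torus.gradient k (x - y) := by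
  refine ext_inner_right ℝ fun w => ?_
  rw [inner_gradient_left, fderiv_comp_sub_left k, inner_neg_left, inner_gradient_left,
    _root_.neg_apply]

omit [Fintype d] in
variable [DecidableEq d] in
/-- Partial derivatives of a negated function. [folklore] -/
theorem partialDeriv_neg (i : d) (f : UnitAddTorus d → F) (x : UnitAddTorus d) :
    partialDeriv i (fun y => -f y) x = -partialDeriv i f x := by
  simp only [partialDeriv, Torus.lineDeriv]
  exact deriv.neg

/-- The Laplacian of a reflected smooth kernel: `Δ(k (x - ·))(y) = Δk (x - y)`. [folklore] -/
theorem laplacian_comp_sub_left {k : UnitAddTorus d → F} (hk : IsSmooth k) (x y : UnitAddTorus d) :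
    Torus.laplacian (fun y => k (x - y)) y = Torus.laplacian k (x - y) := by
  classical
  rw [laplacian_eq_sum_partialDeriv_partialDeriv (hk.comp_sub_left x),
    laplacian_eq_sum_partialDeriv_partialDeriv hk]
  refine Finset.sum_congr rfl fun i _ => ?_
  have h1 : partialDeriv i (fun y => k (x - y)) = fun y => -partialDeriv i k (x - y) :=
    funext (partialDeriv_comp_sub_left (hk.isContDiff (by simp)) i x)
  rw [h1, partialDeriv_neg,
    partialDeriv_comp_sub_left ((hk.partialDeriv i).isContDiff (by simp)) i x y, neg_neg]

end Reflect

/-! ## Convolution on the torus: basic facts -/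

section Basic

variable {E' F' : Type*} [NormedAddCommGroup E'] [NormedSpace ℝ E'] [NormedAddCommGroup F']
  [NormedSpace ℝ F']

/-- On the compact torus, `y ↦ L (θ y) (k (x - y))` is integrable for integrable `θ` and
continuous `k` (Mathlib's `HasCompactSupport.convolutionExists_right`, every function on the
compact torus having compact support). [folklore] -/
theorem convolutionExistsAt_of_continuous (L : E' →L[ℝ] F' →L[ℝ] F) {θ : UnitAddTorus d → E'}
    (hθ : Integrable θ volume) {k : UnitAddTorus d → F'} (hk : Continuous k) (x : UnitAddTorus d) :
    ConvolutionExistsAt θ k x L volume :=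
  (HasCompactSupport.of_compactSpace k).convolutionExists_right L hθ.locallyIntegrable hk x

/-- Integrability of the mollification integrand. [folklore] -/
theorem integrable_smul_comp_sub {θ : UnitAddTorus d → ℝ} (hθ : Integrable θ volume)
    {k : UnitAddTorus d → F} (hk : Continuous k) (x : UnitAddTorus d) :
    Integrable (fun y => θ y • k (x - y)) volume :=
  convolutionExistsAt_of_continuous (lsmul ℝ ℝ) hθ hk x

omit [Fintype d] [NormedSpace ℝ F] in
/-- A continuous function on the compact torus is bounded. [folklore] -/
theorem exists_forall_norm_le_of_continuous {k : UnitAddTorus d → F} (hk : Continuous k) :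
    ∃ C, ∀ x, ‖k x‖ ≤ C :=
  hk.bounded_above_of_compact_support (HasCompactSupport.of_compactSpace k)

/-- Pointwise bound `‖(θ ⋆ k)(x)‖ ≤ C ∫ |θ|` for integrable `θ` and `‖k‖ ≤ C`. [folklore] -/
theorem norm_convolution_le {θ : UnitAddTorus d → ℝ} (hθ : Integrable θ volume)
    {k : UnitAddTorus d → F} {C : ℝ} (hC : ∀ x, ‖k x‖ ≤ C) (x : UnitAddTorus d) :
    ‖(θ ⋆ k) x‖ ≤ C * ∫ y, ‖θ y‖ := by
  rw [convolution_lsmul, mul_comm, ← integral_mul_const]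
  refine norm_integral_le_of_norm_le (hθ.norm.mul_const C) (Eventually.of_forall fun y => ?_)
  rw [norm_smul]
  exact mul_le_mul_of_nonneg_left (hC _) (norm_nonneg _)

end Basic

/-! ## Differentiation under the integral sign -/

section Deriv

/-- The lift of a mollification through the centred fundamental domain:
`lift (θ ⋆ k) w = ∫ θ y • lift k (w - reprc y) dy`. [folklore] -/
theorem lift_convolution (θ : UnitAddTorus d → ℝ) (k : UnitAddTorus d → F) :
    lift (θ ⋆ k) = fun w => ∫ y, θ y • lift k (w - reprc y) := by
  funext w
  rw [lift_apply, convolution_lsmul]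
  simp

/-- The torus derivative `Dk : T^d → (ℝ^d →L F)` of a `C¹` function is continuous. [folklore] -/
theorem IsContDiff.continuous_fderiv {k : UnitAddTorus d → F} (hk : IsContDiff 1 k) :
    Continuous (Torus.fderiv k) := by
  have h : lift (Torus.fderiv k) = _root_.fderiv ℝ (lift k) := funext fun y => (fderiv_lift k y).symm
  rw [← continuous_lift_iff, h]
  exact ContDiff.continuous_fderiv hk one_ne_zero

/-- The lift of `Dk` is `D (lift k)`. [folklore] -/
theorem lift_torusFderiv (k : UnitAddTorus d → F) : lift (Torus.fderiv k) = _root_.fderiv ℝ (lift k) :=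
  funext fun y => (fderiv_lift k y).symm

/-- **Differentiation under the integral sign for mollifications.** For `θ ∈ L¹(T^d)` and a
`C¹` kernel `k`, the lift of `θ ⋆ k` is differentiable with `D(lift (θ ⋆ k))(w) = lift (θ ⋆ Dk)(w)`
(Evans, App. C.4, Thm. 7 (i); Mathlib's `hasFDerivAt_integral_of_dominated_of_fderiv_le` with the
integrable bound `|θ| sup ‖Dk‖`). [folklore] -/
theorem hasFDerivAt_lift_convolution {θ : UnitAddTorus d → ℝ} (hθ : Integrable θ volume)
    {k : UnitAddTorus d → F} (hk : IsContDiff 1 k) (w : EuclideanSpace ℝ d) :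
    HasFDerivAt (lift (θ ⋆ k)) (lift (θ ⋆ Torus.fderiv k) w) w := by
  have hkc : Continuous k := hk.continuous
  have hDc : Continuous (Torus.fderiv k) := hk.continuous_fderiv
  obtain ⟨C, hC⟩ := exists_forall_norm_le_of_continuous hDc
  have hdiff : Differentiable ℝ (lift k) := ContDiff.differentiable hk one_ne_zero
  rw [lift_convolution, lift_convolution]
  simp only [lift_torusFderiv]
  have hrepr : ∀ (w : EuclideanSpace ℝ d) (y : UnitAddTorus d),
      lift k (w - reprc y) = k (proj w - y) := fun w y => by simp
  have hrepr' : ∀ (w : EuclideanSpace ℝ d) (y : UnitAddTorus d),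
      _root_.fderiv ℝ (lift k) (w - reprc y) = Torus.fderiv k (proj w - y) := fun w y => by
    rw [fderiv_lift, proj_sub, proj_reprc]
  refine hasFDerivAt_integral_of_dominated_of_fderiv_le (bound := fun y => ‖θ y‖ * C)
    (F' := fun w y => θ y • _root_.fderiv ℝ (lift k) (w - reprc y)) univ_mem ?_ ?_ ?_ ?_ ?_ ?_
  · refine Eventually.of_forall fun w => ?_
    simp_rw [hrepr]
    exact (integrable_smul_comp_sub hθ hkc (proj w)).aestronglyMeasurable
  · simp_rw [hrepr]
    exact integrable_smul_comp_sub hθ hkc (proj w)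
  · simp_rw [hrepr']
    exact (integrable_smul_comp_sub hθ hDc (proj w)).aestronglyMeasurable
  · refine Eventually.of_forall fun y w _ => ?_
    rw [norm_smul, hrepr']
    exact mul_le_mul_of_nonneg_left (hC _) (norm_nonneg _)
  · exact hθ.norm.mul_const C
  · refine Eventually.of_forall fun y w _ => ?_
    have h := (hdiff (w - reprc y)).hasFDerivAt.comp w ((hasFDerivAt_id w).sub_const (reprc y))
    rw [ContinuousLinearMap.comp_id] at h
    exact h.const_smul (θ y)

/-- `D (lift (θ ⋆ k)) = lift (θ ⋆ Dk)` for `θ ∈ L¹`, `k ∈ C¹`. [folklore] -/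
theorem fderiv_lift_convolution {θ : UnitAddTorus d → ℝ} (hθ : Integrable θ volume)
    {k : UnitAddTorus d → F} (hk : IsContDiff 1 k) :
    _root_.fderiv ℝ (lift (θ ⋆ k)) = lift (θ ⋆ Torus.fderiv k) :=
  funext fun w => (hasFDerivAt_lift_convolution hθ hk w).fderiv

/-- `lift (θ ⋆ k)` is differentiable for `θ ∈ L¹`, `k ∈ C¹`. [folklore] -/
theorem differentiable_lift_convolution {θ : UnitAddTorus d → ℝ} (hθ : Integrable θ volume)
    {k : UnitAddTorus d → F} (hk : IsContDiff 1 k) : Differentiable ℝ (lift (θ ⋆ k)) :=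
  fun w => (hasFDerivAt_lift_convolution hθ hk w).differentiableAt

/-- The torus derivative of a mollification: `D(θ ⋆ k)(x) = (θ ⋆ Dk)(x)`. [folklore] -/
theorem torusFderiv_convolution {θ : UnitAddTorus d → ℝ} (hθ : Integrable θ volume)
    {k : UnitAddTorus d → F} (hk : IsContDiff 1 k) (x : UnitAddTorus d) :
    Torus.fderiv (θ ⋆ k) x = (θ ⋆ Torus.fderiv k) x := by
  obtain ⟨w, rfl⟩ := proj_surjective x
  rw [← fderiv_lift, fderiv_lift_convolution hθ hk, lift_apply]

/-- Evaluation commutes with operator-valued mollification: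
`(θ ⋆ K)(x) v = (θ ⋆ (K · v))(x)` for continuous `K : T^d → (ℝ^d →L F)`. [folklore] -/
theorem convolution_clm_apply {θ : UnitAddTorus d → ℝ} (hθ : Integrable θ volume)
    {K : UnitAddTorus d → EuclideanSpace ℝ d →L[ℝ] F} (hK : Continuous K) (x : UnitAddTorus d)
    (v : EuclideanSpace ℝ d) : (θ ⋆ K) x v = (θ ⋆ fun y => K y v) x := by
  rw [convolution_lsmul, convolution_lsmul, ContinuousLinearMap.integral_apply (integrable_smul_comp_sub hθ hK x)]
  simp

/-- `D(θ ⋆ k)(x) v = (θ ⋆ ∂ᵥk)(x)` with the directional derivative `∂ᵥ k = lineDeriv k · v`. [folklore] -/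
theorem torusFderiv_convolution_apply {θ : UnitAddTorus d → ℝ} (hθ : Integrable θ volume)
    {k : UnitAddTorus d → F} (hk : IsContDiff 1 k) (x : UnitAddTorus d) (v : EuclideanSpace ℝ d) :
    Torus.fderiv (θ ⋆ k) x v = (θ ⋆ fun y => lineDeriv k y v) x := by
  rw [torusFderiv_convolution hθ hk, convolution_clm_apply hθ hk.continuous_fderiv]
  simp_rw [lineDeriv_eq_fderiv_apply hk]

end Deriv

/-! ## Smoothness of mollifications -/

section Smooth

/-- `lift (θ ⋆ k)` is `C^n` for every `n : ℕ`, `θ ∈ L¹` and smooth `k` (induction on `n`: the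
directional derivatives `D(lift (θ ⋆ k)) v = lift (θ ⋆ ∂ᵥ k)` are again mollifications by smooth
kernels; Mathlib's `contDiff_succ_iff_fderiv_apply`). [folklore] -/
theorem contDiff_lift_convolution {θ : UnitAddTorus d → ℝ} (hθ : Integrable θ volume) :
    ∀ (n : ℕ) {k : UnitAddTorus d → F}, IsSmooth k → ContDiff ℝ n (lift (θ ⋆ k))
  | 0, k, hk => by
    rw [Nat.cast_zero, contDiff_zero]
    exact (differentiable_lift_convolution hθ (hk.isContDiff (by simp))).continuous
  | n + 1, k, hk => by
    have hk1 : IsContDiff 1 k := hk.isContDiff (by simp)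
    rw [Nat.cast_succ, contDiff_succ_iff_fderiv_apply]
    refine ⟨differentiable_lift_convolution hθ hk1, fun h => ?_, fun v => ?_⟩
    · exact absurd h (by exact_mod_cast WithTop.coe_ne_top)
    · have h : (fun w => _root_.fderiv ℝ (lift (θ ⋆ k)) w v) = lift (θ ⋆ fun y => lineDeriv k y v) := by
        funext w
        rw [fderiv_lift_convolution hθ hk1, lift_apply, lift_apply,
          convolution_clm_apply hθ hk1.continuous_fderiv]
        simp_rw [lineDeriv_eq_fderiv_apply hk1]
      rw [h]
      exact contDiff_lift_convolution hθ n (hk.lineDeriv v)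

/-- **Mollifications are smooth**: `θ ⋆ k` is smooth on `T^d` for `θ ∈ L¹(T^d)` and smooth `k`
(Evans, App. C.4, Thm. 7 (i)). [folklore] -/
theorem isSmooth_convolution {θ : UnitAddTorus d → ℝ} (hθ : Integrable θ volume)
    {k : UnitAddTorus d → F} (hk : IsSmooth k) : IsSmooth (θ ⋆ k) :=
  contDiff_infty.2 fun n => contDiff_lift_convolution hθ n hk

/-- Mollifications by continuous kernels are continuous (Mathlib). [folklore] -/
theorem continuous_convolution {θ : UnitAddTorus d → ℝ} (hθ : Integrable θ volume)
    {k : UnitAddTorus d → F} (hk : Continuous k) : Continuous (θ ⋆ k) :=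
  (HasCompactSupport.of_compactSpace k).continuous_convolution_right (lsmul ℝ ℝ)
    hθ.locallyIntegrable hk

end Smooth

/-! ## Derivatives of mollifications -/

section Formulas

/-- Mollification is additive in the kernel over finite sums of continuous kernels. [folklore] -/
theorem convolution_finset_sum_right {ι : Type*} {θ : UnitAddTorus d → ℝ} (hθ : Integrable θ volume)
    (s : Finset ι) {g : ι → UnitAddTorus d → F} (hg : ∀ i ∈ s, Continuous (g i)) (x : UnitAddTorus d) :
    (θ ⋆ fun y => ∑ i ∈ s, g i y) x = ∑ i ∈ s, (θ ⋆ g i) x := by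
  simp only [convolution_lsmul, Finset.smul_sum]
  rw [integral_finsetSum _ fun i hi => integrable_smul_comp_sub hθ (hg i hi) x]

variable [DecidableEq d] in
/-- `∂ᵢ (θ ⋆ k) = θ ⋆ ∂ᵢ k` for `θ ∈ L¹` and smooth `k` (Evans, App. C.4, Thm. 7 (i)). [folklore] -/
theorem partialDeriv_convolution {θ : UnitAddTorus d → ℝ} (hθ : Integrable θ volume)
    {k : UnitAddTorus d → F} (hk : IsSmooth k) (i : d) (x : UnitAddTorus d) :
    partialDeriv i (θ ⋆ k) x = (θ ⋆ partialDeriv i k) x := by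
  rw [partialDeriv_eq_fderiv_apply ((isSmooth_convolution hθ hk).isContDiff (by simp)),
    torusFderiv_convolution_apply hθ (hk.isContDiff (by simp))]
  rfl

/-- `Δ(θ ⋆ k) = θ ⋆ Δk` for `θ ∈ L¹` and smooth `k` (Evans, App. C.4, Thm. 7 (i)). [folklore] -/
theorem laplacian_convolution {θ : UnitAddTorus d → ℝ} (hθ : Integrable θ volume)
    {k : UnitAddTorus d → F} (hk : IsSmooth k) (x : UnitAddTorus d) :
    Torus.laplacian (θ ⋆ k) x = (θ ⋆ Torus.laplacian k) x := by
  classical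
  have hL : Torus.laplacian k = fun y => ∑ i, partialDeriv i (partialDeriv i k) y :=
    funext (laplacian_eq_sum_partialDeriv_partialDeriv hk)
  rw [laplacian_eq_sum_partialDeriv_partialDeriv (isSmooth_convolution hθ hk), hL,
    convolution_finset_sum_right hθ _ fun i _ => ((hk.partialDeriv i).partialDeriv i).continuous]
  refine Finset.sum_congr rfl fun i _ => ?_
  have h1 : partialDeriv i (θ ⋆ k) = θ ⋆ partialDeriv i k :=
    funext (partialDeriv_convolution hθ hk i)
  rw [h1, partialDeriv_convolution hθ (hk.partialDeriv i)]

/-- `∇(θ ⋆ k) = θ ⋆ ∇k` for `θ ∈ L¹` and smooth scalar `k` (Evans, App. C.4, Thm. 7 (i)). [folklore] -/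
theorem gradient_convolution {θ : UnitAddTorus d → ℝ} (hθ : Integrable θ volume)
    {k : UnitAddTorus d → ℝ} (hk : IsSmooth k) (x : UnitAddTorus d) :
    Torus.gradient (θ ⋆ k) x = (θ ⋆ Torus.gradient k) x := by
  have hk1 : IsContDiff 1 k := hk.isContDiff (by simp)
  refine ext_inner_right ℝ fun v => ?_
  rw [inner_gradient_left, torusFderiv_convolution_apply hθ hk1, convolution_lsmul, convolution_lsmul,
    real_inner_comm, ← integral_inner (integrable_smul_comp_sub hθ hk.gradient.continuous x)]
  refine integral_congr_ae (Eventually.of_forall fun y => ?_)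
  simp only [smul_eq_mul, real_inner_smul_right]
  rw [real_inner_comm, inner_gradient_left, lineDeriv_eq_fderiv_apply hk1]

/-- `∫_{T^d} ∇k = 0` for smooth `k` (each `∫ ∂ᵢ k = 0`, `Torus.integral_partialDeriv_eq_zero`). [folklore] -/
theorem integral_gradient_eq_zero {k : UnitAddTorus d → ℝ} (hk : IsSmooth k) :
    ∫ y, Torus.gradient k y = 0 := by
  classical
  simp_rw [gradient_eq_sum_partialDeriv (hk.isContDiff (by simp))]
  rw [integral_finsetSum _ fun i _ => ((hk.partialDeriv i).integrable.smul_const _)]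
  refine Finset.sum_eq_zero fun i _ => ?_
  rw [integral_smul_const, integral_partialDeriv_eq_zero_holds hk i, zero_smul]

end Formulas

/-! ## Young's inequality for real mollifications -/

section Young

/-- `(lsmul ℝ ℝ).flip = lsmul ℝ ℝ`: real multiplication is commutative. [folklore] -/
theorem lsmul_flip_real : (lsmul ℝ ℝ : ℝ →L[ℝ] ℝ →L[ℝ] ℝ).flip = lsmul ℝ ℝ := by
  ext
  simp

/-- Real convolution on the (abelian) torus is commutative: `θ ⋆ k = k ⋆ θ`
(Mathlib's `convolution_flip`). [folklore] -/
theorem convolution_comm_real (θ k : UnitAddTorus d → ℝ) : θ ⋆ k = k ⋆ θ := by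
  have h := convolution_flip (L := (lsmul ℝ ℝ : ℝ →L[ℝ] ℝ →L[ℝ] ℝ)) (f := k) (g := θ)
    (μ := (volume : Measure (UnitAddTorus d)))
  rwa [lsmul_flip_real] at h

/-- **Young's inequality** on the torus for real functions: `‖θ ⋆ k‖_{Lᵖ} ≤ ‖k‖_{L¹} ‖θ‖_{Lᵖ}`,
`1 ≤ p ≤ ∞` (commutativity and the tree's `Literature.Analysis.UnboundedOperators.eLpNorm_convolution_le_lintegral_enorm_mul`;
Grafakos, Thm. 1.2.10). [folklore] -/
theorem eLpNorm_convolution_le {θ k : UnitAddTorus d → ℝ} (hθ : AEStronglyMeasurable θ volume)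
    (hk : AEStronglyMeasurable k volume) {p : ℝ≥0∞} (hp : 1 ≤ p) :
    eLpNorm (θ ⋆ k) p volume ≤ (∫⁻ y, ‖k y‖ₑ) * eLpNorm θ p volume := by
  rw [convolution_comm_real]
  exact Literature.Analysis.UnboundedOperators.eLpNorm_convolution_le_lintegral_enorm_mul hk hθ hp

/-- For a nonnegative kernel, `∫⁻ ‖k‖ₑ = ENNReal.ofReal (∫ k)`. [folklore] -/
theorem lintegral_enorm_eq_ofReal_integral {k : UnitAddTorus d → ℝ} (hk : Integrable k volume)
    (hnn : ∀ y, 0 ≤ k y) : ∫⁻ y, ‖k y‖ₑ = ENNReal.ofReal (∫ y, k y) := by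
  rw [← ofReal_integral_norm_eq_lintegral_enorm hk]
  congr 1
  exact integral_congr_ae (Eventually.of_forall fun y => by
    simp [Real.norm_eq_abs, abs_of_nonneg (hnn y)])

/-- Mollification is subtractive in the function: `(θ - g) ⋆ k = θ ⋆ k - g ⋆ k` for integrable
`θ`, `g` and continuous `k`. [folklore] -/
theorem sub_convolution {θ g : UnitAddTorus d → ℝ} (hθ : Integrable θ volume) (hg : Integrable g volume)
    {k : UnitAddTorus d → F} (hk : Continuous k) : (θ - g) ⋆ k = θ ⋆ k - g ⋆ k := by
  funext x
  simp only [Pi.sub_apply, convolution_lsmul, sub_smul]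
  exact integral_sub (integrable_smul_comp_sub hθ hk x) (integrable_smul_comp_sub hg hk x)

end Young

/-! ## Approximate identities -/

section ApproxIdentity

variable {F' : Type*} [NormedAddCommGroup F'] [NormedSpace ℝ F'] [CompleteSpace F']

/-- **Uniform approximation of continuous functions.** For continuous `g : T^d → F'` and
`η > 0` there is `δ > 0` such that `‖(k ⋆ g)(x) - g(x)‖ ≤ η` for all `x` and every kernel
`k ≥ 0` of unit mass supported in `B(0, δ)` (uniform continuity on the compact torus and
Mathlib's `dist_convolution_le`; Evans, App. C.4, Thm. 7 (iii)). [folklore] -/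
theorem exists_forall_dist_convolution_le {g : UnitAddTorus d → F'} (hg : Continuous g) {η : ℝ}
    (hη : 0 < η) :
    ∃ δ > 0, ∀ {k : UnitAddTorus d → ℝ}, support k ⊆ ball 0 δ → (∀ y, 0 ≤ k y) →
      ∫ y, k y = 1 → ∀ x, dist ((k ⋆ g) x) (g x) ≤ η := by
  obtain ⟨δ, hδ, h⟩ := Metric.uniformContinuous_iff.1
    (CompactSpace.uniformContinuous_of_continuous hg) η hη
  refine ⟨δ, hδ, fun hsupp hnn hint x => ?_⟩
  exact dist_convolution_le hη.le hsupp hnn hint hg.aestronglyMeasurable fun y hy =>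
    (h (mem_ball.1 hy)).le

/-- **`L²` convergence of mollifications** (Evans, App. C.4, Thm. 7 (iv), on `T^d`): for
`θ ∈ L²(T^d)` and continuous kernels `kₙ ≥ 0` of unit mass with `support kₙ ⊆ B(0, δₙ)`,
`δₙ → 0`, one has `‖θ ⋆ kₙ - θ‖_{L²} → 0` (density of continuous functions in `L²`, Mathlib's
`MemLp.exists_boundedContinuous_eLpNorm_sub_le`, Young's inequality and the uniform
approximation of continuous functions). [folklore] -/
theorem tendsto_eLpNorm_convolution_sub_self {θ : UnitAddTorus d → ℝ} (hθ : MemLp θ 2 volume)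
    {k : ℕ → UnitAddTorus d → ℝ} {δ : ℕ → ℝ} (hk_nn : ∀ n y, 0 ≤ k n y)
    (hk_int : ∀ n, ∫ y, k n y = 1) (hk_supp : ∀ n, support (k n) ⊆ ball 0 (δ n))
    (hk_cont : ∀ n, Continuous (k n)) (hδ : Tendsto δ atTop (𝓝 0)) :
    Tendsto (fun n => eLpNorm (θ ⋆ k n - θ) 2 volume) atTop (𝓝 0) := by
  have hθi : Integrable θ volume := hθ.integrable one_le_two
  have hk1 : ∀ n, ∫⁻ y, ‖k n y‖ₑ = 1 := fun n => by
    rw [lintegral_enorm_eq_ofReal_integral (hk_cont n).integrable_unitAddTorus (hk_nn n), hk_int n,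
      ENNReal.ofReal_one]
  rw [ENNReal.tendsto_atTop_zero]
  intro ε hε
  -- work with `ε' = min ε 1 < ∞` and `η = ε' / 3`
  set ε' : ℝ≥0∞ := min ε 1 with hε'
  have hε'0 : ε' ≠ 0 := (lt_min hε zero_lt_one).ne'
  have hε't : ε' ≠ ⊤ := (min_le_right _ _).trans_lt ENNReal.one_lt_top |>.ne
  set η : ℝ≥0∞ := ε' / 3 with hη
  have hη0 : η ≠ 0 := (ENNReal.div_pos_iff.2 ⟨hε'0, by norm_num⟩).ne'
  have hηt : η ≠ ⊤ := ENNReal.div_ne_top hε't (by norm_num)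
  -- a continuous `g` close to `θ` in `L²`
  obtain ⟨gb, hgθ, -⟩ := hθ.exists_boundedContinuous_eLpNorm_sub_le ENNReal.ofNat_ne_top hη0
  set g : UnitAddTorus d → ℝ := ⇑gb with hg_def
  have hgc : Continuous g := gb.continuous
  have hgi : Integrable g volume := hgc.integrable_unitAddTorus
  -- uniform approximation of `g`
  obtain ⟨δ₀, hδ₀, hU⟩ := exists_forall_dist_convolution_le hgc (ENNReal.toReal_pos hη0 hηt)
  obtain ⟨N, hN⟩ := eventually_atTop.1 (hδ.eventually (gt_mem_nhds hδ₀))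
  refine ⟨N, fun n hn => ?_⟩
  have hsupp : support (k n) ⊆ ball 0 δ₀ := (hk_supp n).trans (ball_subset_ball (hN n hn).le)
  -- the three pieces
  have hdecomp : θ ⋆ k n - θ = ((θ - g) ⋆ k n) + (g ⋆ k n - g) + (g - θ) := by
    rw [sub_convolution hθi hgi (hk_cont n)]
    abel
  have hm1 : AEStronglyMeasurable ((θ - g) ⋆ k n) volume :=
    (continuous_convolution (hθi.sub hgi) (hk_cont n)).aestronglyMeasurable
  have hm2 : AEStronglyMeasurable (g ⋆ k n - g) volume :=
    ((continuous_convolution hgi (hk_cont n)).sub hgc).aestronglyMeasurable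
  have hm3 : AEStronglyMeasurable (g - θ) volume :=
    hgc.aestronglyMeasurable.sub hθ.aestronglyMeasurable
  have h1 : eLpNorm ((θ - g) ⋆ k n) 2 volume ≤ η := by
    refine (eLpNorm_convolution_le (hθ.aestronglyMeasurable.sub hgc.aestronglyMeasurable)
      (hk_cont n).aestronglyMeasurable one_le_two).trans ?_
    rw [hk1 n, one_mul]
    exact hgθ
  have h2 : eLpNorm (g ⋆ k n - g) 2 volume ≤ η := by
    have hb : ∀ᵐ x ∂(volume : Measure (UnitAddTorus d)),
        ‖(g ⋆ k n - g) x‖ ≤ η.toReal := Eventually.of_forall fun x => by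
      rw [Pi.sub_apply, convolution_comm_real, ← dist_eq_norm]
      exact hU hsupp (hk_nn n) (hk_int n) x
    refine (eLpNorm_le_of_ae_bound hb).trans ?_
    rw [measure_univ, ENNReal.one_rpow, one_mul, ENNReal.ofReal_toReal hηt]
  have h3 : eLpNorm (g - θ) 2 volume ≤ η := by
    rw [eLpNorm_sub_comm]
    exact hgθ
  calc eLpNorm (θ ⋆ k n - θ) 2 volume
      ≤ eLpNorm (((θ - g) ⋆ k n) + (g ⋆ k n - g)) 2 volume +
          eLpNorm (g - θ) 2 volume := by
        rw [hdecomp]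
        exact eLpNorm_add_le (hm1.add hm2) hm3 one_le_two
    _ ≤ η + η + η := by
        gcongr
        exact (eLpNorm_add_le hm1 hm2 one_le_two).trans (add_le_add h1 h2)
    _ = ε' := by rw [hη, ENNReal.add_thirds]
    _ ≤ ε := min_le_left _ _

end ApproxIdentity

/-! ## Measurability of parametrised convolutions -/

section Param

variable {α : Type*} [MeasurableSpace α] {μ : Measure α} [SFinite μ]
variable {E' F' : Type*} [NormedAddCommGroup E'] [NormedSpace ℝ E'] [NormedAddCommGroup F']
  [NormedSpace ℝ F']

omit [Fintype d] in
/-- `((a, x), y) ↦ (a, y)` is measure preserving from `(μ ⊗ vol) ⊗ vol` to `μ ⊗ vol` on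
`(α × T^d) × T^d` (the torus has total mass one). [folklore] -/
theorem measurePreserving_prodMap_fst [Fintype d] :
    MeasurePreserving (Prod.map Prod.fst id : (α × UnitAddTorus d) × UnitAddTorus d → α × UnitAddTorus d)
      ((μ.prod volume).prod volume) (μ.prod volume) :=
  (measurePreserving_fst (μ := μ) (ν := (volume : Measure (UnitAddTorus d)))).prod
    (MeasurePreserving.id volume)

omit [NormedSpace ℝ E'] in
/-- A jointly measurable `Θ : α × T^d → E'` read in the variables `(a, y)` of
`((a, x), y) ∈ (α × T^d) × T^d` is jointly measurable. [folklore] -/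
theorem aestronglyMeasurable_comp_fst_snd {Θ : α → UnitAddTorus d → E'}
    (hΘ : AEStronglyMeasurable (uncurry Θ) (μ.prod volume)) :
    AEStronglyMeasurable (fun q : (α × UnitAddTorus d) × UnitAddTorus d => Θ q.1.1 q.2)
      ((μ.prod volume).prod volume) :=
  hΘ.comp_measurePreserving measurePreserving_prodMap_fst

omit [SFinite μ] [NormedSpace ℝ E'] in
/-- A jointly measurable `U : α × T^d → E'` read in the variables `(a, x)` of
`((a, x), y) ∈ (α × T^d) × T^d` is jointly measurable. [folklore] -/
theorem aestronglyMeasurable_comp_fst {U : α → UnitAddTorus d → E'}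
    (hU : AEStronglyMeasurable (uncurry U) (μ.prod volume)) :
    AEStronglyMeasurable (fun q : (α × UnitAddTorus d) × UnitAddTorus d => U q.1.1 q.1.2)
      ((μ.prod volume).prod volume) :=
  hU.comp_measurePreserving (measurePreserving_fst (μ := μ.prod volume)
    (ν := (volume : Measure (UnitAddTorus d))))

/-- **Parametrised convolutions are jointly measurable**: if `Θ : α × T^d → E'` is a.e.-strongly
measurable for `μ ⊗ vol` and `k` is continuous, then `(a, x) ↦ (Θ a ⋆[L] k)(x)` is a.e.-strongly
measurable for `μ ⊗ vol` (Fubini: Mathlib's `AEStronglyMeasurable.integral_prod_right'`). [folklore] -/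
theorem aestronglyMeasurable_uncurry_convolution (L : E' →L[ℝ] F' →L[ℝ] F)
    {Θ : α → UnitAddTorus d → E'} (hΘ : AEStronglyMeasurable (uncurry Θ) (μ.prod volume))
    {k : UnitAddTorus d → F'} (hk : Continuous k) :
    AEStronglyMeasurable (uncurry fun a x => (Θ a ⋆[L] k) x) (μ.prod volume) := by
  set Ψ : (α × UnitAddTorus d) × UnitAddTorus d → F := fun q => L (Θ q.1.1 q.2) (k (q.1.2 - q.2))
    with hΨ
  have hΨm : AEStronglyMeasurable Ψ ((μ.prod volume).prod volume) :=
    L.continuous₂.comp_aestronglyMeasurable₂ (aestronglyMeasurable_comp_fst_snd hΘ)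
      (hk.comp_aestronglyMeasurable
        ((measurable_fst.snd.sub measurable_snd).aestronglyMeasurable))
  have h : uncurry (fun a x => (Θ a ⋆[L] k) x) = fun p : α × UnitAddTorus d => ∫ y, Ψ (p, y) := by
    funext p
    simp only [uncurry, convolution_def, hΨ]
  rw [h]
  exact hΨm.integral_prod_right'

end Param

end Torus

end Literature.Analysis.FunctionSpaces
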